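import Summits.BirchSwinnertonDyer.Rank1Residual.Additive.GreenbergVatsalTorsionRamifiedQuotient
import Summits.BirchSwinnertonDyer.Rank1Residual.X2.GreenbergVatsalTorsionLine
import HarnessLib

/-!
# Greenberg–Vatsal 2000, pp. 26–27 at a RAMIFIED quotient: "the order of `S^{Σ₀}_{A_i[p]}(ℚ_∞)` is
# independent of `i` since `A₁[p] ≅ A₂[p]`" under REMARK (2.9) (`D^{I_p} = 0`) and with the line
# `C[p] = A[p]^{I_p}` (the twisted / flipped ordinary datum of an additive potentially ordinary `p`,
# e.g. EVERY additive potentially ordinary or potentially multiplicative prime at `p = 3`) — the GV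
# TRANSFER COUNT in the kernel, no image hypothesis (cell `b2b-bsdres`, team n1011, seat p12 (gen 4);
# row T-E3g-GV29 FILE 2; ROUTE-2 II.15.4 ARM α "`hirr ↦ E₁(ℚ)[p] = 0`", kernel half)

HONEST FRAMING (cell `b2b-bsdres`, run/shared/lean/b2b/bsd-rank1-residual/, verbatim in every
file): the goal of the cell is to DELETE the COMBINATION-SHAPED residual classes of the
Birch–Swinnerton-Dyer formula for ALL analytic-rank `≤ 1` elliptic curves over `ℚ` — "full BSD
formula for every rank `≤ 1` curve in class `C`" assembled STRICTLY from published theorems — so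
that the rank-`≤ 1` remainder becomes exactly the CONSTRUCTION-SHAPED classes, which are TYPED
(missing-input `Prop`s), NOT attempted. This is not "finishing BSD". Team n1011: research routes on
CONSTRUCTION-SHAPED classes; prove what is provable now; no claim beyond stated classes; census
output = EVIDENCE, never a Literature fact; RESIDUAL-MAP marks UNCHANGED; nothing is booked by this
file. THEOREMS ONLY: no definition, no named fact; eisenstein-p2's `X2.GreenbergVatsalTorsionIso` /
`X2.GreenbergVatsalTorsionLine` are consumed BY NAME and untouched.

## What and why

GV p. 26: "for an odd prime `p`, the group `S_{A[p]}(ℚ_∞)` is determined just by the isomorphism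
class of `A[p]` as a `G_ℚ`-module. This follows from the remark … `C[p] = μ_p` and `D[p]` is the
maximal quotient of `A[p]` on which `I_p` acts trivially"; p. 27: "by proposition (2.8), we have
`Sel^{Σ₀}_{E_i}(ℚ_∞)[p] = S^{Σ₀}_{A_i}(ℚ_∞)[p] ≅ S^{Σ₀}_{A_i[p]}(ℚ_∞)`. Furthermore, the order of this
group is independent of `i` since `A₁[p] ≅ A₂[p]` as `G_ℚ`-modules."

eisenstein-p2 proved this in the kernel for data on whose quotient `D` INERTIA ACTS TRIVIALLY and
whose line is MOVED by inertia (`X2.GreenbergVatsalTorsionLine.natCard_gvSelmer_inf_torsion_mul_eq_of_inertia`,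
hypotheses `htriv_i`, `hgen_i`) — GV's printed shape (`C[p] ≅ μ_p` ramified, `D[p]` unramified). At an
ADDITIVE potentially ordinary prime with inertial character `ε̄ = ω^k`, `C[p]|_{I_p} = ω^{1−k}` and
`D[p]|_{I_p} = ω^k` (ROUTE-2 II.15.4): `D` is RAMIFIED (`D^{I} = 0`, Remark (2.9)) and, on the rows with
`k ≡ 1 (mod p−1)` — `e = p − 1`: EVERY additive potentially ordinary / potentially multiplicative
prime at `p = 3`, the `e = 4` rows at `5`, the `e = 6` rows at `7` (cc-typer-1's `TwistedOrdinaryLineAt`,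
`Additive/MixedCongruenceTameness.lean`) — the line `C[p]` is FIXED pointwise by inertia: the roles
are FLIPPED, and the intrinsic description of the datum becomes **`C[p] = A[p]^{I_p}`** (the fixed
vectors), which every equivariant isomorphism respects trivially. THIS FILE:

* §1 `map_plus_eq_of_fixedPoints` — an equivariant `θ : N₁ ≃ N₂` carries `N₁⁺_v` onto `N₂⁺_v` as
  soon as `N_i⁺_v = N_i^{I_v}` (the TRANSPOSE of eisenstein-p2's `map_plus_eq_of_inertia`);
* §2 `natCard_gvSelmer_inf_torsion_mul_eq_of_divisible_invariants` — GV's two-module comparison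
  WITHOUT `H⁰ = 0` in the Remark-(2.9) form: `#(S^{Σ₀}_{M₁}(L) ⊓ H¹[n])·#M₁^H[n] =
  #(S^{Σ₀}_{M₂}(L) ⊓ H¹[n])·#M₂^H[n]` for any `Γ_K`-isomorphism `θ : M₁[n] ≃ M₂[n]` carrying
  `M₁[n] ∩ M₁⁺_v` onto `M₂[n] ∩ M₂⁺_v`, the local hypotheses at `v ∣ p` being `M_i⁺_v` `n`-divisible
  and `H⁰(H ⊓ I_v, M_i/M_i⁺_v)` `n`-divisible inside itself (FILE 1
  `natCard_gvSelmer_torsion_of_divisible_invariants_of_finite` + eisenstein-p2's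
  `natCard_gvSelmer_eq_of_equiv`); `…_of_invariants_eq_bot_of_fixedPoints` — the flipped-datum form
  (`D_i^{H ⊓ I_v} = 0`, `M_i[n] ∩ M_i⁺_v = M_i[n]^{I_v}`), for ANY `Γ_K`-isomorphism `θ : M₁[n] ≃ M₂[n]`;
* §3 the curve form: two elliptic curves `E₁`, `E₂` over a number field `K`, data `(C_{i,v})_{v∣p}`
  with `C_{i,v}` `p`-divisible, `(E_i[p^∞]/C_{i,v})^{H ⊓ I_v} = 0` and `E_i[p] ∩ C_{i,v} = E_i[p]^{I_v}`,
  `S₀ ⊇` the bad places `≠ p` of both, `E_i(L)[p^∞]` finite, and `θ : E₁[p] ≃ E₂[p]` equivariant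
  (reducible `E_i[p]` allowed — NO irreducibility anywhere) ⟹
  `#(S^{S₀}_{E₁[p^∞]}(L) ⊓ H¹[p]) · #E₁(L)[p] = #(S^{S₀}_{E₂[p^∞]}(L) ⊓ H¹[p]) · #E₂(L)[p]`.

NOT here: the link `Sel_{p^∞}(E/ℚ_∞) = S(ℚ_∞)` at an additive `p` (T-RD-Δ), the `λ`-reading
(`μ = 0 ⟹ #S^{Σ₀}_A[p] = p^{λ+Σδ}`: Props. (2.5)/(2.8) second half, Cor. (2.3) — typed elsewhere, the
(2.5) fact needing the same Remark-(2.9) re-typing), the discharge of the three displayed local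
hypotheses from `IsRamifiedOrdinaryLine` / `TwistedOrdinaryLineAt` data; any class theorem.

References: [GreenbergVatsal2000] §2 Prop. (2.8), Remark (2.9), pp. 26–27 (held text
`paper:arxiv-math_9906215`); ROUTE-2 II.15.4 (ARM α); eisenstein-p2 `X2/GreenbergVatsalTorsionIso.lean`,
`X2/GreenbergVatsalTorsionLine.lean`; cc-typer-1 `Additive/MixedCongruenceTameness.lean`.
-/

set_option autoImplicit false

noncomputable section

open scoped Classical AddSubgroup
universe u

open NumberField IsDedekindDomain Field
open Literature.NumberTheory.EllipticCurves Literature.NumberTheory.EllipticCurves.GreenbergSelmer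
  Literature.NumberTheory.GaloisRepresentations
  Summit.BirchSwinnertonDyer.Rank1Residual.X2.TorsionComparison
  Summit.BirchSwinnertonDyer.Rank1Residual.X2.GreenbergVatsalTorsion
  Summit.BirchSwinnertonDyer.Rank1Residual.X2.GreenbergVatsalTorsionIso
  Summit.BirchSwinnertonDyer.Rank1Residual.Additive.GreenbergVatsalTorsionRamified

namespace Summit.BirchSwinnertonDyer.Rank1Residual.Additive.GreenbergVatsalTransferRamified

variable {K : Type u} [Field K] [NumberField K]

/-! ## §1. FLIPPED intrinsic data: `N⁺_v = N^{I_v}` is respected by every equivariant isomorphism -/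

section Intrinsic

variable {N₁ : Type u} [AddCommGroup N₁] [DistribMulAction (absoluteGaloisGroup K) N₁]
variable {N₂ : Type u} [AddCommGroup N₂] [DistribMulAction (absoluteGaloisGroup K) N₂]
variable {v : HeightOneSpectrum (𝓞 K)} (D₁ : LocalDatum K N₁ v) (D₂ : LocalDatum K N₂ v)
  (θ : N₁ ≃+ N₂)

/-- **One inclusion: `θ(N₁⁺) ⊆ N₂⁺`** if `N₁⁺` is fixed pointwise by `I_v` and every `I_v`-fixed
vector of `N₂` lies in `N₂⁺` (then `θ c` is `I_v`-fixed, `θ` being equivariant). The transpose of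
eisenstein-p2's `map_plus_le_of_inertia`. [cite: GreenbergVatsal2000, §2 p. 26] -/
theorem map_plus_le_of_fixedPoints
    (hθ : ∀ (g : absoluteGaloisGroup K) (m : N₁), θ (g • m) = g • θ m)
    (hfix₁ : ∀ τ ∈ inertia v, ∀ c ∈ D₁.plus, τ • c = c)
    (hmax₂ : ∀ x : N₂, (∀ τ ∈ inertia v, τ • x = x) → x ∈ D₂.plus) :
    D₁.plus.map (θ : N₁ →+ N₂) ≤ D₂.plus := by
  rintro _ ⟨c, hc, rfl⟩
  refine hmax₂ _ fun τ hτ ↦ ?_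
  change τ • θ c = θ c
  rw [← hθ, hfix₁ τ hτ c hc]

/-- **`θ(N₁⁺_v) = N₂⁺_v` for EVERY equivariant isomorphism `θ : N₁ ≃ N₂`** when, for `i = 1, 2`,
`N_i⁺_v` is exactly the subgroup of `I_v`-FIXED vectors (the flipped / twisted ordinary datum: `C[p]`
unramified, `D[p]` ramified with `D[p]^{I} = 0`). The transpose of eisenstein-p2's
`map_plus_eq_of_inertia` (GV's printed case: `C[p] = μ_p` moved, `D[p]` fixed).
[cite: GreenbergVatsal2000, §2 p. 26] -/
theorem map_plus_eq_of_fixedPoints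
    (hθ : ∀ (g : absoluteGaloisGroup K) (m : N₁), θ (g • m) = g • θ m)
    (hfix₁ : ∀ τ ∈ inertia v, ∀ c ∈ D₁.plus, τ • c = c)
    (hfix₂ : ∀ τ ∈ inertia v, ∀ c ∈ D₂.plus, τ • c = c)
    (hmax₁ : ∀ x : N₁, (∀ τ ∈ inertia v, τ • x = x) → x ∈ D₁.plus)
    (hmax₂ : ∀ x : N₂, (∀ τ ∈ inertia v, τ • x = x) → x ∈ D₂.plus) :
    D₁.plus.map (θ : N₁ →+ N₂) = D₂.plus := by
  refine le_antisymm (map_plus_le_of_fixedPoints D₁ D₂ θ hθ hfix₁ hmax₂) fun c hc ↦ ?_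
  have hθ' : ∀ (g : absoluteGaloisGroup K) (m : N₂), θ.symm (g • m) = g • θ.symm m :=
    symm_equivariant θ hθ
  have hmem : θ.symm c ∈ D₁.plus :=
    map_plus_le_of_fixedPoints D₂ D₁ θ.symm hθ' hfix₂ hmax₁ ⟨c, hc, rfl⟩
  exact ⟨θ.symm c, hmem, θ.apply_symm_apply c⟩

end Intrinsic

/-! ## §2. GV's two-module comparison WITHOUT `H⁰ = 0`, Remark-(2.9) local hypotheses -/

section Transfer

variable (H : Subgroup (absoluteGaloisGroup K)) [H.Normal]
variable (M₁ : Type u) [AddCommGroup M₁] [DistribMulAction (absoluteGaloisGroup K) M₁]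
  [TopologicalSpace M₁] [DiscreteTopology M₁]
variable (M₂ : Type u) [AddCommGroup M₂] [DistribMulAction (absoluteGaloisGroup K) M₂]
  [TopologicalSpace M₂] [DiscreteTopology M₂]
variable (p : ℕ) (L₁ : Data K M₁ p) (L₂ : Data K M₂ p) (S₀ : Set (HeightOneSpectrum (𝓞 K))) (n : ℕ)

/-- **Greenberg–Vatsal's comparison WITHOUT `H⁰ = 0`, two modules, Remark-(2.9) form.** Let `M₁`,
`M₂` be `n`-divisible discrete `Γ_K`-modules with continuous orbit maps, unramified at the finite
`v ∉ S₀`, `v ∤ p`, with Greenberg data `M_i⁺_v` (`v ∣ p`) that are `n`-divisible and whose quotients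
have `H⁰(H ⊓ I_v, M_i/M_i⁺_v)` `n`-divisible inside itself (e.g. `= 0`), with finite invariants
`M_i^H`, and let `θ : M₁[n] ≃ M₂[n]` be a `Γ_K`-isomorphism carrying `M₁[n] ∩ M₁⁺_v` onto
`M₂[n] ∩ M₂⁺_v`. Then
**`#(S^{S₀}_{M₁}(L) ⊓ H¹(H,M₁)[n]) · #M₁^H[n] = #(S^{S₀}_{M₂}(L) ⊓ H¹(H,M₂)[n]) · #M₂^H[n]`**
(both sides `= #S^{S₀}_{M_i[n]}(L)`, FILE 1, which agree, eisenstein-p2's `natCard_gvSelmer_eq_of_equiv`).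
[cite: GreenbergVatsal2000, §2 Prop. (2.8), Remark (2.9) and pp. 26–27] -/
theorem natCard_gvSelmer_inf_torsion_mul_eq_of_divisible_invariants
    (hM₁ : ∀ m : M₁, Continuous fun g : absoluteGaloisGroup K ↦ g • m)
    (hM₂ : ∀ m : M₂, Continuous fun g : absoluteGaloisGroup K ↦ g • m)
    (hdiv₁ : ∀ m : M₁, ∃ m' : M₁, n • m' = m) (hdiv₂ : ∀ m : M₂, ∃ m' : M₂, n • m' = m)
    (hunr₁ : ∀ v : HeightOneSpectrum (𝓞 K), v ∉ S₀ → ((p : ℕ) : 𝓞 K) ∉ v.asIdeal →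
      ∀ x ∈ inertia v, ∀ m : M₁, x • m = m)
    (hunr₂ : ∀ v : HeightOneSpectrum (𝓞 K), v ∉ S₀ → ((p : ℕ) : 𝓞 K) ∉ v.asIdeal →
      ∀ x ∈ inertia v, ∀ m : M₂, x • m = m)
    (hplus₁ : ∀ (v : HeightOneSpectrum (𝓞 K)) (hv : ((p : ℕ) : 𝓞 K) ∈ v.asIdeal),
      ∀ c ∈ (L₁ v hv).plus, ∃ c' ∈ (L₁ v hv).plus, n • c' = c)
    (hplus₂ : ∀ (v : HeightOneSpectrum (𝓞 K)) (hv : ((p : ℕ) : 𝓞 K) ∈ v.asIdeal),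
      ∀ c ∈ (L₂ v hv).plus, ∃ c' ∈ (L₂ v hv).plus, n • c' = c)
    (hdivI₁ : ∀ (v : HeightOneSpectrum (𝓞 K)) (hv : ((p : ℕ) : 𝓞 K) ∈ v.asIdeal),
      ∀ a ∈ invariants (inertiaIn H v) (L₁ v hv).Gr,
        ∃ q₀ ∈ invariants (inertiaIn H v) (L₁ v hv).Gr, n • q₀ = a)
    (hdivI₂ : ∀ (v : HeightOneSpectrum (𝓞 K)) (hv : ((p : ℕ) : 𝓞 K) ∈ v.asIdeal),
      ∀ a ∈ invariants (inertiaIn H v) (L₂ v hv).Gr,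
        ∃ q₀ ∈ invariants (inertiaIn H v) (L₂ v hv).Gr, n • q₀ = a)
    [Finite (invariants H M₁)] [Finite (invariants H M₂)]
    (θ : M₁[(n : ℤ)] ≃+ M₂[(n : ℤ)])
    (hθ : ∀ (g : absoluteGaloisGroup K) (m : M₁[(n : ℤ)]), θ (g • m) = g • θ m)
    (hθL : ∀ (v : HeightOneSpectrum (𝓞 K)) (hv : ((p : ℕ) : 𝓞 K) ∈ v.asIdeal),
      (torsionData L₁ n v hv).plus.map (θ : M₁[(n : ℤ)] →+ M₂[(n : ℤ)]) =
        (torsionData L₂ n v hv).plus) :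
    Nat.card (gvSelmer H M₁ p L₁ S₀ ⊓ (subgroupH1 H M₁)[(n : ℤ)] : AddSubgroup (subgroupH1 H M₁)) *
        Nat.card ((invariants H M₁)[(n : ℤ)]) =
      Nat.card (gvSelmer H M₂ p L₂ S₀ ⊓ (subgroupH1 H M₂)[(n : ℤ)] :
          AddSubgroup (subgroupH1 H M₂)) * Nat.card ((invariants H M₂)[(n : ℤ)]) := by
  rw [← natCard_gvSelmer_torsion_of_divisible_invariants_of_finite H M₁ p L₁ S₀ n hM₁ hdiv₁ hunr₁
      hplus₁ hdivI₁,
    ← natCard_gvSelmer_torsion_of_divisible_invariants_of_finite H M₂ p L₂ S₀ n hM₂ hdiv₂ hunr₂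
      hplus₂ hdivI₂]
  exact natCard_gvSelmer_eq_of_equiv H θ (torsionData L₁ n) (torsionData L₂ n) S₀ hθL hθ

/-- **The FLIPPED-datum transfer** ("the order of `S^{Σ₀}_{A_i[π]}` is independent of `i`", GV p. 27,
at a ramified quotient): as `natCard_gvSelmer_inf_torsion_mul_eq_of_divisible_invariants` with the
Remark-(2.9) case `(M_i/M_i⁺_v)^{H ⊓ I_v} = 0` and the data INTRINSIC in the flipped sense —
`M_i[n] ∩ M_i⁺_v` is exactly the subgroup of `I_v`-fixed vectors of `M_i[n]` — so that ANY
`Γ_K`-isomorphism `θ : M₁[n] ≃ M₂[n]` qualifies (§1). [cite: GreenbergVatsal2000, §2 Remark (2.9) and pp. 26–27] -/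
theorem natCard_gvSelmer_inf_torsion_mul_eq_of_invariants_eq_bot_of_fixedPoints
    (hM₁ : ∀ m : M₁, Continuous fun g : absoluteGaloisGroup K ↦ g • m)
    (hM₂ : ∀ m : M₂, Continuous fun g : absoluteGaloisGroup K ↦ g • m)
    (hdiv₁ : ∀ m : M₁, ∃ m' : M₁, n • m' = m) (hdiv₂ : ∀ m : M₂, ∃ m' : M₂, n • m' = m)
    (hunr₁ : ∀ v : HeightOneSpectrum (𝓞 K), v ∉ S₀ → ((p : ℕ) : 𝓞 K) ∉ v.asIdeal →
      ∀ x ∈ inertia v, ∀ m : M₁, x • m = m)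
    (hunr₂ : ∀ v : HeightOneSpectrum (𝓞 K), v ∉ S₀ → ((p : ℕ) : 𝓞 K) ∉ v.asIdeal →
      ∀ x ∈ inertia v, ∀ m : M₂, x • m = m)
    (hplus₁ : ∀ (v : HeightOneSpectrum (𝓞 K)) (hv : ((p : ℕ) : 𝓞 K) ∈ v.asIdeal),
      ∀ c ∈ (L₁ v hv).plus, ∃ c' ∈ (L₁ v hv).plus, n • c' = c)
    (hplus₂ : ∀ (v : HeightOneSpectrum (𝓞 K)) (hv : ((p : ℕ) : 𝓞 K) ∈ v.asIdeal),
      ∀ c ∈ (L₂ v hv).plus, ∃ c' ∈ (L₂ v hv).plus, n • c' = c)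
    (h0₁ : ∀ (v : HeightOneSpectrum (𝓞 K)) (hv : ((p : ℕ) : 𝓞 K) ∈ v.asIdeal),
      ∀ a ∈ invariants (inertiaIn H v) (L₁ v hv).Gr, a = 0)
    (h0₂ : ∀ (v : HeightOneSpectrum (𝓞 K)) (hv : ((p : ℕ) : 𝓞 K) ∈ v.asIdeal),
      ∀ a ∈ invariants (inertiaIn H v) (L₂ v hv).Gr, a = 0)
    (hfix₁ : ∀ (v : HeightOneSpectrum (𝓞 K)) (hv : ((p : ℕ) : 𝓞 K) ∈ v.asIdeal),
      ∀ τ ∈ inertia v, ∀ c ∈ (torsionData L₁ n v hv).plus, τ • c = c)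
    (hfix₂ : ∀ (v : HeightOneSpectrum (𝓞 K)) (hv : ((p : ℕ) : 𝓞 K) ∈ v.asIdeal),
      ∀ τ ∈ inertia v, ∀ c ∈ (torsionData L₂ n v hv).plus, τ • c = c)
    (hmax₁ : ∀ (v : HeightOneSpectrum (𝓞 K)) (hv : ((p : ℕ) : 𝓞 K) ∈ v.asIdeal),
      ∀ x : M₁[(n : ℤ)], (∀ τ ∈ inertia v, τ • x = x) → x ∈ (torsionData L₁ n v hv).plus)
    (hmax₂ : ∀ (v : HeightOneSpectrum (𝓞 K)) (hv : ((p : ℕ) : 𝓞 K) ∈ v.asIdeal),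
      ∀ x : M₂[(n : ℤ)], (∀ τ ∈ inertia v, τ • x = x) → x ∈ (torsionData L₂ n v hv).plus)
    [Finite (invariants H M₁)] [Finite (invariants H M₂)]
    (θ : M₁[(n : ℤ)] ≃+ M₂[(n : ℤ)])
    (hθ : ∀ (g : absoluteGaloisGroup K) (m : M₁[(n : ℤ)]), θ (g • m) = g • θ m) :
    Nat.card (gvSelmer H M₁ p L₁ S₀ ⊓ (subgroupH1 H M₁)[(n : ℤ)] : AddSubgroup (subgroupH1 H M₁)) *
        Nat.card ((invariants H M₁)[(n : ℤ)]) =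
      Nat.card (gvSelmer H M₂ p L₂ S₀ ⊓ (subgroupH1 H M₂)[(n : ℤ)] :
          AddSubgroup (subgroupH1 H M₂)) * Nat.card ((invariants H M₂)[(n : ℤ)]) :=
  natCard_gvSelmer_inf_torsion_mul_eq_of_divisible_invariants H M₁ M₂ p L₁ L₂ S₀ n hM₁ hM₂ hdiv₁
    hdiv₂ hunr₁ hunr₂ hplus₁ hplus₂
    (fun v hv ↦ divisible_invariants_of_invariants_eq_bot H M₁ n (L₁ v hv) (h0₁ v hv))
    (fun v hv ↦ divisible_invariants_of_invariants_eq_bot H M₂ n (L₂ v hv) (h0₂ v hv)) θ hθ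
    fun v hv ↦
      map_plus_eq_of_fixedPoints (torsionData L₁ n v hv) (torsionData L₂ n v hv) θ hθ (hfix₁ v hv)
        (hfix₂ v hv) (hmax₁ v hv) (hmax₂ v hv)

end Transfer

/-! ## §3. Two elliptic curves with isomorphic `p`-torsion and FLIPPED ordinary data at `v ∣ p` -/

section Curve

variable (p : ℕ) [Fact p.Prime] (H : Subgroup (absoluteGaloisGroup K)) [H.Normal]
  (W₁ : WeierstrassCurve K) [W₁.IsElliptic] (W₂ : WeierstrassCurve K) [W₂.IsElliptic]
  (L₁ : Data K (W₁.geomPrimaryTorsion p) p) (L₂ : Data K (W₂.geomPrimaryTorsion p) p)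
  (S₀ : Set (HeightOneSpectrum (𝓞 K)))

/-- **GV's transfer count for two curves with `E₁[p] ≅ E₂[p]` at a RAMIFIED quotient with FLIPPED
lines (reducible `E_i[p]` allowed).** Let `E₁`, `E₂` be elliptic curves over a number field `K`, good
outside `S₀ ∪ {v ∣ p}`, with Greenberg data `C_{i,v} ⊂ E_i[p^∞]` (`v ∣ p`) such that `C_{i,v}` is
`p`-divisible, `(E_i[p^∞]/C_{i,v})^{H ⊓ I_v} = 0` and `E_i[p] ∩ C_{i,v}` is exactly the subgroup of
`I_v`-fixed vectors of `E_i[p]`; assume `E_i(L)[p^∞]` finite (`L = K̄^H`, e.g. `K_∞`). Then for EVERY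
`Γ_K`-isomorphism `θ : E₁[p] ≃ E₂[p]` (on `E_i[p^∞][p]`):
`#(S^{S₀}_{E₁[p^∞]}(L) ⊓ H¹[p]) · #E₁(L)[p] = #(S^{S₀}_{E₂[p^∞]}(L) ⊓ H¹[p]) · #E₂(L)[p]`.
NO irreducibility, NO image hypothesis, NO `H⁰ = 0`. The reducible / additive twin (at `D^{I} = 0`,
`C[p] = A[p]^{I}`) of eisenstein-p2's `GreenbergVatsalTransferCurve`.
[cite: GreenbergVatsal2000, §2 Prop. (2.8), Remark (2.9) and pp. 26–27] [cite: SilvermanAEC2009, Prop. VII.4.1(a)] -/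
theorem natCard_gvSelmer_inf_torsion_mul_eq_curve_of_fixedPoints
    (hS₁ : ∀ v : HeightOneSpectrum (𝓞 K), v ∉ S₀ → ((p : ℕ) : 𝓞 K) ∉ v.asIdeal →
      W₁.HasGoodReductionAt v)
    (hS₂ : ∀ v : HeightOneSpectrum (𝓞 K), v ∉ S₀ → ((p : ℕ) : 𝓞 K) ∉ v.asIdeal →
      W₂.HasGoodReductionAt v)
    (hplus₁ : ∀ (v : HeightOneSpectrum (𝓞 K)) (hv : ((p : ℕ) : 𝓞 K) ∈ v.asIdeal),
      ∀ c ∈ (L₁ v hv).plus, ∃ c' ∈ (L₁ v hv).plus, p • c' = c)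
    (hplus₂ : ∀ (v : HeightOneSpectrum (𝓞 K)) (hv : ((p : ℕ) : 𝓞 K) ∈ v.asIdeal),
      ∀ c ∈ (L₂ v hv).plus, ∃ c' ∈ (L₂ v hv).plus, p • c' = c)
    (h0₁ : ∀ (v : HeightOneSpectrum (𝓞 K)) (hv : ((p : ℕ) : 𝓞 K) ∈ v.asIdeal),
      ∀ a ∈ invariants (inertiaIn H v) (L₁ v hv).Gr, a = 0)
    (h0₂ : ∀ (v : HeightOneSpectrum (𝓞 K)) (hv : ((p : ℕ) : 𝓞 K) ∈ v.asIdeal),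
      ∀ a ∈ invariants (inertiaIn H v) (L₂ v hv).Gr, a = 0)
    (hfix₁ : ∀ (v : HeightOneSpectrum (𝓞 K)) (hv : ((p : ℕ) : 𝓞 K) ∈ v.asIdeal),
      ∀ τ ∈ inertia v, ∀ c ∈ (torsionData L₁ p v hv).plus, τ • c = c)
    (hfix₂ : ∀ (v : HeightOneSpectrum (𝓞 K)) (hv : ((p : ℕ) : 𝓞 K) ∈ v.asIdeal),
      ∀ τ ∈ inertia v, ∀ c ∈ (torsionData L₂ p v hv).plus, τ • c = c)
    (hmax₁ : ∀ (v : HeightOneSpectrum (𝓞 K)) (hv : ((p : ℕ) : 𝓞 K) ∈ v.asIdeal),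
      ∀ x : (W₁.geomPrimaryTorsion p)[(p : ℤ)], (∀ τ ∈ inertia v, τ • x = x) →
        x ∈ (torsionData L₁ p v hv).plus)
    (hmax₂ : ∀ (v : HeightOneSpectrum (𝓞 K)) (hv : ((p : ℕ) : 𝓞 K) ∈ v.asIdeal),
      ∀ x : (W₂.geomPrimaryTorsion p)[(p : ℤ)], (∀ τ ∈ inertia v, τ • x = x) →
        x ∈ (torsionData L₂ p v hv).plus)
    [hfin₁ : Finite (FixedPoints.addSubgroup H (W₁.geomPrimaryTorsion p))]
    [hfin₂ : Finite (FixedPoints.addSubgroup H (W₂.geomPrimaryTorsion p))]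
    (θ : (W₁.geomPrimaryTorsion p)[(p : ℤ)] ≃+ (W₂.geomPrimaryTorsion p)[(p : ℤ)])
    (hθ : ∀ (g : absoluteGaloisGroup K) (m : (W₁.geomPrimaryTorsion p)[(p : ℤ)]),
      θ (g • m) = g • θ m) :
    Nat.card (gvSelmer H (W₁.geomPrimaryTorsion p) p L₁ S₀ ⊓
          (subgroupH1 H (W₁.geomPrimaryTorsion p))[(p : ℤ)] :
          AddSubgroup (subgroupH1 H (W₁.geomPrimaryTorsion p))) *
        Nat.card ((FixedPoints.addSubgroup H (W₁.geomPrimaryTorsion p))[(p : ℤ)]) =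
      Nat.card (gvSelmer H (W₂.geomPrimaryTorsion p) p L₂ S₀ ⊓
          (subgroupH1 H (W₂.geomPrimaryTorsion p))[(p : ℤ)] :
          AddSubgroup (subgroupH1 H (W₂.geomPrimaryTorsion p))) *
        Nat.card ((FixedPoints.addSubgroup H (W₂.geomPrimaryTorsion p))[(p : ℤ)]) := by
  haveI : Finite (invariants H (W₁.geomPrimaryTorsion p)) := hfin₁
  haveI : Finite (invariants H (W₂.geomPrimaryTorsion p)) := hfin₂
  exact natCard_gvSelmer_inf_torsion_mul_eq_of_invariants_eq_bot_of_fixedPoints H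
    (W₁.geomPrimaryTorsion p) (W₂.geomPrimaryTorsion p) p L₁ L₂ S₀ p
    (X2.GreenbergVatsalTorsionCurve.continuous_smul_curve W₁ p)
    (X2.GreenbergVatsalTorsionCurve.continuous_smul_curve W₂ p)
    (X2.GreenbergVatsalTorsionCurve.divisible_curve W₁ p)
    (X2.GreenbergVatsalTorsionCurve.divisible_curve W₂ p)
    (X2.GreenbergVatsalTorsionCurve.unramified_outside W₁ p S₀ hS₁)
    (X2.GreenbergVatsalTorsionCurve.unramified_outside W₂ p S₀ hS₂) hplus₁ hplus₂ h0₁ h0₂ hfix₁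
    hfix₂ hmax₁ hmax₂ θ hθ

end Curve

end Summit.BirchSwinnertonDyer.Rank1Residual.Additive.GreenbergVatsalTransferRamified

end
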